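import Summits.Ventures.CertifiedManyBodySolver.Theorems.TcThermcert1FreeGasSectorLogZ
import Summits.Ventures.CertifiedManyBodySolver.Theorems.TcThermcert1FreeGasAnalyticInputs
import Summits.Ventures.CertifiedManyBodySolver.Theorems.TcThermcert1FreeGasPinningInputs
import Summits.Ventures.CertifiedManyBodySolver.Observables.StiffnessThermalLeafAtBeta
import HarnessLib

/-!
# Free-gas (`U = 0`) sector witness for TcThermcert1's K1 family — part 7: the witness statement, its readings, the analytic core as a `Prop`, and the composition

`TwistInsensitiveAt` / `leafAtBeta_of_twistInsensitiveAt` (idea-1's socket: qualitative twist-insensitivity of the sector free energy ⇒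
the thermal stiffness-ceiling leaf with any constant `c ≥ 0`), `FreeGasSectorTwistInsensitive` (the card's witness statement),
`EsymmLogTwistInsensitive` (the analytic core), the compositions `freeGasSectorTwistInsensitive_of`, `freeGas_rung_of`, `freeGas_K1twin_of'`
(glue + core ⇒ `ObsThermalStiffnessSeqCeilingAtBeta 0 0 (7/8) β 0` for every `β > 0` and K1's signature with `U = 8 ↦ 0`), and the
model-specific input `freeBandOccupationVariance : FreeBandOccupationVariance` (a flux-independent positive fraction of the `L²` modes
is partially occupied at every pinned fugacity).
HONEST FRAMING: statements about the FREE (`U = 0`) twisted torus gas and about symmetric functions of explicit reals;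
nothing here touches `U = 8`; superconductivity in the Hubbard model is NOT proved (or disproved) by any of this.
Provenance: landed form of the crux workfile `Cruxes/ThermalStiffnessCeilingU8b10_le_1o8/FreeGasArcSkeleton.lean` v4.1 (tree 80a90c42bbb7)
+ `FreeGasArcInputs.lean` (d3c3c585d14e), planner `hubbard-floor-idea-rescuer` g5, card `free-gas-arc-darroch` (crit-1 KEEP);
hubbard-floor support target ST-K1-U0-1, `--supports stmt-Ventures-26381` (TcThermcert1 crux K1). Split into ≤ 400-line modules
`Theorems/TcThermcert1FreeGas*.lean`.
-/

noncomputable section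

namespace Summit.Ventures.CertifiedManyBodySolver.Theorems.FreeGasArc

open Filter Topology Set Real Finset
open Summit.Ventures.CertifiedManyBodySolver.Observables
open Literature.MathematicalPhysics.QuantumLattice
open Literature.Probability.LatticeModels (TorusSite latticeMomentum)
open scoped BigOperators

/-! ## §0 Idea-1's socket (verbatim from `Cruxes/…/ZeroFreeCorridorSketch.lean`, which is not a built module) -/

/-- [idea-1, `ZeroFreeCorridorSketch.TwistInsensitiveAt`, verbatim] Qualitative twist-insensitivity of the `(N_L, S^z=0)` sector
free energy at inverse temperature `β`: for some flux scale `θ₁ > 0`, `|log Z_L(0) − log Z_L(θ)| ≤ ε_L → 0` uniformly in `|θ| ≤ θ₁`. -/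
def TwistInsensitiveAt (tp U n β : ℝ) : Prop :=
  ∃ θ₁ : ℝ, 0 < θ₁ ∧ ∃ ε : ℕ → ℝ, Tendsto ε atTop (𝓝 0) ∧ ∃ L₀ : ℕ,
    ∀ (L : ℕ) [NeZero L], L₀ ≤ L → ∀ θ : ℝ, |θ| ≤ θ₁ →
      |thermalFluxLogZ L tp U (1 - n) β 0 - thermalFluxLogZ L tp U (1 - n) β θ| ≤ ε L

/-- [idea-1, `ZeroFreeCorridorSketch.leafAtBeta_of_twistInsensitiveAt`, verbatim; PROVED] Twist-insensitivity at `β > 0` forces the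
single-temperature thermal stiffness leaf for every `c ≥ 0`. -/
theorem leafAtBeta_of_twistInsensitiveAt {tp U n β : ℝ} (hβ : 0 < β) {c : ℚ} (_hc : 0 ≤ c)
    (h : TwistInsensitiveAt tp U n β) : ObsThermalStiffnessSeqCeilingAtBeta tp U n β c := by
  intro ρs θ₀ hρs hθ₀ Ls hLs hst
  obtain ⟨θ₁, hθ₁, ε, hε, L₀, hins⟩ := h
  exfalso
  set θ : ℝ := min θ₀ θ₁ with hθdef
  have hθpos : 0 < θ := lt_min hθ₀ hθ₁
  have hθ0 : |θ| ≤ θ₀ := by rw [abs_of_pos hθpos]; exact min_le_left _ _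
  have hθ1 : |θ| ≤ θ₁ := by rw [abs_of_pos hθpos]; exact min_le_right _ _
  have hev : ∀ᶠ j in atTop, β * ρs * θ ^ 2 ≤ ε (Ls j) := by
    have h1 : ∀ᶠ j in atTop, max 1 L₀ ≤ Ls j := hLs.eventually (eventually_ge_atTop (max 1 L₀))
    filter_upwards [h1] with j hj
    haveI : NeZero (Ls j) := ⟨by omega⟩
    have ha := hst j θ hθ0
    have hb := hins (Ls j) (le_of_max_le_right hj) θ hθ1
    exact ha.trans ((le_abs_self _).trans hb)
  have hlim : Tendsto (fun j => ε (Ls j)) atTop (𝓝 0) := hε.comp hLs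
  have hle : β * ρs * θ ^ 2 ≤ 0 := ge_of_tendsto hlim hev
  have hpos : 0 < β * ρs * θ ^ 2 := by positivity
  linarith

/-! ## §1 The witness statement (card) and its readings -/

/-- **Free-gas sector twist-insensitivity** at hopping data `(1, tp)`, `U = 0`, filling `n`: at EVERY `β > 0` the
`(N_L, S^z = 0)` sector log-partition function of the flux-twisted torus is twist-insensitive. -/
def FreeGasSectorTwistInsensitive (tp n : ℝ) : Prop :=
  ∀ β : ℝ, 0 < β → TwistInsensitiveAt tp 0 n β

/-- The witness gives the single-temperature leaf at `U = 0` for EVERY `β > 0` and EVERY `c ≥ 0`. -/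
theorem freeGasLeaf_of {tp n : ℝ} (h : FreeGasSectorTwistInsensitive tp n) {β : ℝ} (hβ : 0 < β) {c : ℚ}
    (hc : 0 ≤ c) : ObsThermalStiffnessSeqCeilingAtBeta tp 0 n β c :=
  leafAtBeta_of_twistInsensitiveAt hβ hc (h β hβ)

/-- The analytic core as a `Prop`: for every `β > 0`, `2 log e_{M_L}(w_L(β, ·))` is twist-insensitive on a flux window,
eventually in `L`, with a null sequence `ε_L(β)` (card: `ε_L ≤ C(β) L² e^{−a(β)L}` with `a(β) = arsinh((π − φ₀)/(2β))`-type
strip width; crit-1: vacuous below `L ≈ 200` at `β = 10`, irrelevant for the `L → ∞` leaf). -/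
def EsymmLogTwistInsensitive : Prop :=
  ∀ β : ℝ, 0 < β → ∃ θ₁ : ℝ, 0 < θ₁ ∧ ∃ ε : ℕ → ℝ, Tendsto ε atTop (𝓝 0) ∧ ∃ L₀ : ℕ,
    ∀ (L : ℕ) [NeZero L], L₀ ≤ L → ∀ θ : ℝ, |θ| ≤ θ₁ →
      |2 * Real.log (esymmW (freeWeight L β 0) (halfCount L)) -
          2 * Real.log (esymmW (freeWeight L β θ) (halfCount L))| ≤ ε L

-- v3: the former `stub_esymmLogTwistInsensitive` is the theorem `esymmLogTwistInsensitive_holds` (§4); v4: the former stub 1 is the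
-- theorem `stub_sectorLogZ_free` (§6, placed above); the rung and K1's `U = 0` twin `freeGas_rung` / `freeGas_K1twin` (§5) are unconditional.

/-! ### The kernel-checked composition -/

/-- Stub 1 as a `Prop` (the shape consumed by the composition). -/
def SectorLogZFreeFactorisation : Prop :=
  ∀ (β θ : ℝ) (L : ℕ) [NeZero L], 3 ≤ L →
    thermalFluxLogZ L 0 0 (1 - 7 / 8) β θ = 2 * Real.log (esymmW (freeWeight L β θ) (halfCount L))

/-- Stub 1's `Prop` holds (by `stub_sectorLogZ_free`). -/
theorem sectorLogZFreeFactorisation_of_stub : SectorLogZFreeFactorisation :=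
  fun β θ L _ hL => stub_sectorLogZ_free β θ L hL

/-- **Composition (PROVED):** model glue + analytic core ⇒ the card's witness `FreeGasSectorTwistInsensitive 0 (7/8)`. -/
theorem freeGasSectorTwistInsensitive_of (h1 : SectorLogZFreeFactorisation) (h2 : EsymmLogTwistInsensitive) :
    FreeGasSectorTwistInsensitive 0 (7 / 8) := by
  intro β hβ
  obtain ⟨θ₁, hθ₁, ε, hε, L₀, hins⟩ := h2 β hβ
  refine ⟨θ₁, hθ₁, ε, hε, max 3 L₀, ?_⟩
  intro L _ hL θ hθ
  rw [h1 β 0 L (le_of_max_le_left hL), h1 β θ L (le_of_max_le_left hL)]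
  exact hins L (le_of_max_le_right hL) θ hθ

/-- **The rung (PROVED from the two stubs):** `ObsThermalStiffnessSeqCeilingAtBeta 0 0 (7/8) β 0` for every `β > 0` — K1's
exact observable family with the interaction switched off and the constant `0` (K1 has `U = 8`, constant `1/8`). -/
theorem freeGas_rung_of (h1 : SectorLogZFreeFactorisation) (h2 : EsymmLogTwistInsensitive) {β : ℝ} (hβ : 0 < β) :
    ObsThermalStiffnessSeqCeilingAtBeta 0 0 (7 / 8) β 0 :=
  freeGasLeaf_of (freeGasSectorTwistInsensitive_of h1 h2) hβ le_rfl

/-- **K1's literal `U = 0` twin (PROVED from the two stubs):** `ObsThermalStiffnessSeqCeilingAtBeta 0 0 (7/8) 10 (1/8)`. -/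
theorem freeGas_K1twin_of' (h1 : SectorLogZFreeFactorisation) (h2 : EsymmLogTwistInsensitive) :
    ObsThermalStiffnessSeqCeilingAtBeta 0 0 (7 / 8) 10 (1 / 8) :=
  freeGasLeaf_of (freeGasSectorTwistInsensitive_of h1 h2) (by norm_num) (by norm_num)

/-! ## §3 Second layer of the analytic core: the generic inputs (parts 4–6) re-exported, the model-specific one proved -/

/-- PROVED generic input (arc): the shifted-grid trapezoid bound (Trefethen–Weideman, tree). -/
theorem shiftedTrapezoidShift : FreeGasArc.Inputs.ShiftedTrapezoidShift :=
  FreeGasArc.Inputs.shiftedTrapezoidShift_holds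

/-- PROVED generic input (off-arc): Gaussian decay of `∏(1 + uᵢe^{iφ})` away from `φ = 0`. -/
theorem offArcGaussianDecay : FreeGasArc.Inputs.OffArcGaussianDecay :=
  FreeGasArc.Inputs.offArcGaussianDecay_holds

/-- PROVED generic input (floor; the Darroch bypass): every degree is a mode at some fugacity, polynomial floor. -/
theorem esymmModeFugacity : FreeGasArc.Inputs.EsymmModeFugacity :=
  FreeGasArc.Inputs.esymmModeFugacity_holds

/-- PROVED generic input (strip): the one-line logarithm `Log(1 + exp(s + iφ + 2β cos z + 2β cos p₂))` is
`2π`-periodic, holomorphic and bounded on `|Im z| < min 1 (π/(24β))`, and exponentiates back on the real line. -/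
theorem freeBandLogStrip : FreeGasArc.Inputs.FreeBandLogStrip :=
  FreeGasArc.Inputs.freeBandLogStrip_holds

/-- **Model-specific input (the only one): the occupation variance is extensive on the pinned fugacity window.**
For `β > 0` there are `c > 0` and `L₀` such that for all `L ≥ L₀`, all real `θ` with `|θ| ≤ π` and every log-fugacity
`s ∈ [−4β − 1, 4β + 1]`, `∑_k u_k/(1 + u_k)² ≥ c·L²` with `u_k = e^{s} w_k(β, θ)`.  (Pinning to this window:
`FreeGasArc.Inputs.modeFugacity_pinned` with `b = e^{−4β}`, `B = e^{4β}`, `M_L = ⌊7L²/16⌋`, `n = L²`.) -/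
def FreeBandOccupationVariance : Prop :=
  ∀ β : ℝ, 0 < β → ∃ c : ℝ, 0 < c ∧ ∃ L₀ : ℕ, ∀ (L : ℕ) [NeZero L], L₀ ≤ L → ∀ θ : ℝ, |θ| ≤ π →
    ∀ s : ℝ, -4 * β - 1 ≤ s → s ≤ 4 * β + 1 →
      c * (L : ℝ) ^ 2 ≤ ∑ k : TorusSite 2 L,
        Real.exp s * freeWeight L β θ k / (1 + Real.exp s * freeWeight L β θ k) ^ 2

/-- The twisted free band is bounded by `4`: `|ξ_k(θ)| = |−2cos(p₁ − θ/L) − 2cos p₂| ≤ 4`. -/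
theorem abs_twistedBand_le (L : ℕ) (θ : ℝ) (k : TorusSite 2 L) : |twistedBand L ![θ, 0] 0 k| ≤ 4 := by
  unfold twistedBand
  rw [sub_zero, Fin.sum_univ_two]
  have hA := abs_le.1 (Real.abs_cos_le_one (latticeMomentum L k 0 - (![θ, 0] : Fin 2 → ℝ) 0 / L))
  have hB := abs_le.1 (Real.abs_cos_le_one (latticeMomentum L k 1 - (![θ, 0] : Fin 2 → ℝ) 1 / L))
  rw [abs_le]
  constructor <;> nlinarith [hA.1, hA.2, hB.1, hB.2]

/-- **The model-specific input holds**, with `c = e^{−(8β+1)}/4` and `L₀ = 0`: EVERY mode contributes, since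
`|s − βξ_k| ≤ 8β + 1` and `u/(1+u)² ≥ e^{−|log u|}/4` (no shell counting is needed for the `L → ∞` leaf). -/
theorem freeBandOccupationVariance : FreeBandOccupationVariance := by
  intro β hβ
  refine ⟨Real.exp (-(8 * β + 1)) / 4, by positivity, 0, ?_⟩
  intro L _ _ θ _ s hs1 hs2
  have hcard : (Fintype.card (TorusSite 2 L) : ℝ) = (L : ℝ) ^ 2 := by
    rw [Fintype.card_fun, ZMod.card, Fintype.card_fin]
    push_cast
    ring
  have hterm : ∀ k : TorusSite 2 L, Real.exp (-(8 * β + 1)) / 4 ≤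
      Real.exp s * freeWeight L β θ k / (1 + Real.exp s * freeWeight L β θ k) ^ 2 := by
    intro k
    have hξ := abs_le.1 (abs_twistedBand_le L θ k)
    have hu : Real.exp s * freeWeight L β θ k = Real.exp (s + -β * twistedBand L ![θ, 0] 0 k) := by
      rw [freeWeight, Real.exp_add]
    rw [hu]
    have hx1 : -(8 * β + 1) ≤ s + -β * twistedBand L ![θ, 0] 0 k := by nlinarith [hξ.1, hξ.2, hβ]
    have hx2 : s + -β * twistedBand L ![θ, 0] 0 k ≤ 8 * β + 1 := by nlinarith [hξ.1, hξ.2, hβ]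
    have hupos : 0 < Real.exp (s + -β * twistedBand L ![θ, 0] 0 k) := Real.exp_pos _
    rw [div_le_div_iff₀ (by norm_num : (0:ℝ) < 4) (by positivity)]
    have h1 : Real.exp (-(8 * β + 1)) ≤ Real.exp (s + -β * twistedBand L ![θ, 0] 0 k) := Real.exp_le_exp.2 hx1
    have h2 : Real.exp (-(8 * β + 1)) * Real.exp (s + -β * twistedBand L ![θ, 0] 0 k) ≤ 1 := by
      rw [← Real.exp_add]
      exact Real.exp_le_one_iff.2 (by linarith)
    have h3 : Real.exp (-(8 * β + 1)) ≤ 1 := Real.exp_le_one_iff.2 (by linarith)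
    nlinarith [hupos, h1, h2, h3, mul_le_mul_of_nonneg_right h2 hupos.le, mul_le_mul_of_nonneg_right h3 hupos.le]
  calc Real.exp (-(8 * β + 1)) / 4 * (L : ℝ) ^ 2
      = ∑ _k : TorusSite 2 L, Real.exp (-(8 * β + 1)) / 4 := by
        rw [Finset.sum_const, Finset.card_univ, nsmul_eq_mul, hcard]
        ring
    _ ≤ _ := Finset.sum_le_sum fun k _ => hterm k

end Summit.Ventures.CertifiedManyBodySolver.Theorems.FreeGasArc

end
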